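import Literature.NumberTheory.EllipticCurves.Tian2014.CMPointSystemDisplays
import Literature.NumberTheory.EllipticCurves.TianYuanZhang2017.GenusDescentDefs
import Literature.GroupTheory.FiniteAbelian.StableTransversals
import HarnessLib

/-!
# Monsky 1990 Thms. 4.5 and 4.7 transplanted onto Tian's CM points: `2y_{2n,φ}` and (for composite `n`, via an
# ambiguous class `B ∉ {1, [ϖ′]}`) `y_{2n,φ}` itself are transfers of rational points of `E_{2n}` — "`S_N ∈ Λ_N`"

Cell `bsd-monsky` (typer seat), kernel work K1 (`run/shared/lean/pub/bsd-monsky/lean/PLAN.md` tier 2), first half.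
On the displayed data of `Tian2014/CMPointSystemDisplays.lean` (Tian Thm. 2.8 (1)–(3), (4.8), the Galois facts):
the Galois bookkeeping of Monsky's proofs (Thm. 4.5 p. 57, Thm. 4.7 pp. 57–58; = Tian Prop. 4.6 (4.7)–(4.9) and
the second read's CLAIM (4.7-T), `p2/lit/L2-38-RT15c-SECOND-READ-lit2.md` §6), then Galois descent
(`exists_transferE_eq_of_forall_gal`). Every theorem is a Lean proof of a printed step; nothing asserted.
[cite: Monsky1990MockHeegner, Thm. 4.5 (p. 57), Thm. 4.7 (pp. 57–58), Remark (p. 57), Def. 4.4 (p. 56)]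
[cite: Tian2014, Prop. 4.6 proof (p0023 L26–L45), §4.2 (p0022 L84–L96)]
-/

noncomputable section

open scoped Classical

open WeierstrassCurve NumberField Literature.NumberTheory.EllipticCurves
  Literature.NumberTheory.EllipticCurves.TianYuanZhang2017 Literature.GroupTheory.FiniteAbelian

namespace Literature.NumberTheory.EllipticCurves.Tian2014

/-! ## §K1.b Monsky Thm. 4.5 transplanted: `2y_{2n,φ}` is the transfer of a rational point -/

namespace CMPointData

variable {n : ℕ}

/-- `σ ↦ σ_*` is multiplicative: `(στ)_* = σ_* ∘ τ_*`. [cite: Tian2014, Def. 2.7 (p0011 L35–L36: z_t := z^{σ_t})] [folklore] -/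
theorem act_mul (D : CMPointData n) (σ τ : D.H ≃ₐ[ℚ] D.H) (P : EPoint D.H) :
    D.act (σ * τ) P = D.act σ (D.act τ P) := by
  unfold act
  rw [WeierstrassCurve.Affine.Point.map_map]
  rfl

/-- `1_* = id`. [cite: Tian2014, Def. 2.7 (p0011 L35–L36)] [folklore] -/
theorem act_one (D : CMPointData n) (P : EPoint D.H) : D.act 1 P = P := by
  unfold act
  exact WeierstrassCurve.Affine.Point.map_id P

/-- **The stabiliser of a point is a subgroup of `Gal(H/ℚ)`.** [cite: Monsky1990MockHeegner, Thm. 4.5 proof (p. 57: "2S_N is fixed by the elements of G(H(i)/K(i,√N))")] [folklore] -/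
def stabilizer (D : CMPointData n) (P : EPoint D.H) : Subgroup (D.H ≃ₐ[ℚ] D.H) where
  carrier := {σ | D.act σ P = P}
  one_mem' := D.act_one P
  mul_mem' := by
    intro σ τ hσ hτ
    show D.act (σ * τ) P = P
    rw [D.act_mul, hτ, hσ]
  inv_mem' := by
    intro σ hσ
    show D.act σ⁻¹ P = P
    have : D.act σ⁻¹ (D.act σ P) = P := by rw [← D.act_mul, inv_mul_cancel, D.act_one]
    rwa [show D.act σ P = P from hσ] at this

/-- Membership in the stabiliser. [cite: Monsky1990MockHeegner, Thm. 4.5 proof (p. 57)] [folklore] -/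
theorem mem_stabilizer_iff (D : CMPointData n) (P : EPoint D.H) (σ : D.H ≃ₐ[ℚ] D.H) :
    σ ∈ D.stabilizer P ↔ D.act σ P = P := Iff.rfl

/-- The transversal `[ϖ′]·φ` … every translate `s·φ` of a transversal of `𝒜/[ϖ′]` is a transversal. [cite: Monsky1990MockHeegner, Thm. 4.5 proof (p. 57: "S_{N,J⁻¹φ}")] [folklore] -/
theorem isRepsModPiPrime_image_mul (D : CMPointData n)
    {φ : Finset (ClassGroup (𝓞 (GenusField (2 * n))))} (hφ : D.IsRepsModPiPrime φ)
    (s : ClassGroup (𝓞 (GenusField (2 * n)))) : D.IsRepsModPiPrime (φ.image (fun t => s * t)) := by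
  intro t
  have h1 : t ∈ φ.image (fun t => s * t) ↔ s⁻¹ * t ∈ φ := by
    rw [Finset.mem_image]
    constructor
    · rintro ⟨u, hu, rfl⟩; simpa using hu
    · intro hu; exact ⟨s⁻¹ * t, hu, by simp⟩
  have h2 : D.piPrime * t ∈ φ.image (fun t => s * t) ↔ D.piPrime * (s⁻¹ * t) ∈ φ := by
    rw [Finset.mem_image]
    constructor
    · rintro ⟨u, hu, hut⟩
      have : u = D.piPrime * (s⁻¹ * t) := by
        calc u = s⁻¹ * (s * u) := by rw [← mul_assoc, inv_mul_cancel, one_mul]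
          _ = s⁻¹ * (D.piPrime * t) := by rw [hut]
          _ = D.piPrime * (s⁻¹ * t) := by rw [mul_left_comm]
      rw [← this]; exact hu
    · intro hu
      refine ⟨D.piPrime * (s⁻¹ * t), hu, ?_⟩
      show s * (D.piPrime * (s⁻¹ * t)) = D.piPrime * t
      rw [mul_left_comm, mul_inv_cancel_left]
  rw [h1, h2]
  exact hφ (s⁻¹ * t)

/-- The inverse `φ⁻¹` of a transversal of `𝒜/[ϖ′]` is a transversal (`[ϖ′]` has order `2`). [cite: Monsky1990MockHeegner, Thm. 4.5 proof (p. 57: "S_{N,φ⁻¹}")] [folklore] -/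
theorem isRepsModPiPrime_image_inv (D : CMPointData n) (hπ : D.piPrime * D.piPrime = 1)
    {φ : Finset (ClassGroup (𝓞 (GenusField (2 * n))))} (hφ : D.IsRepsModPiPrime φ) :
    D.IsRepsModPiPrime (φ.image (fun t => t⁻¹)) := by
  intro t
  have hπinv : D.piPrime⁻¹ = D.piPrime := by
    rw [inv_eq_of_mul_eq_one_right hπ]
  have h1 : t ∈ φ.image (fun t => t⁻¹) ↔ t⁻¹ ∈ φ := by
    rw [Finset.mem_image]
    constructor
    · rintro ⟨u, hu, rfl⟩; simpa using hu
    · intro hu; exact ⟨t⁻¹, hu, by simp⟩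
  have h2 : D.piPrime * t ∈ φ.image (fun t => t⁻¹) ↔ D.piPrime * t⁻¹ ∈ φ := by
    rw [Finset.mem_image]
    constructor
    · rintro ⟨u, hu, hut⟩
      have : u = D.piPrime * t⁻¹ := by
        rw [← inv_inv u, hut, mul_inv, hπinv]
      rw [← this]; exact hu
    · intro hu; exact ⟨D.piPrime * t⁻¹, hu, by rw [mul_inv, hπinv, inv_inv]⟩
  rw [h1, h2]
  exact hφ t⁻¹

/-- **Changing the transversal moves `y_{2n,φ}` by a `2`-torsion point** (Tian §4.2: "the point `y_{d,φ}` is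
independent of `φ` up to `E[2]` by Theorem 2.8 (3)"): for two transversals `φ`, `φ′`,
`2·y_{2n,φ′} = 2·y_{2n,φ}`. Proof: `φ′ = (φ′ ∩ φ) ⊔ [ϖ′]·(φ ∖ φ′)` and `z_{[ϖ′]t} = z_t + (±1, 0)`.
[cite: Tian2014, §4.2 (p0022 L89–L94); Thm. 2.8 (3) (p0011 L42–L44)] -/
theorem two_nsmul_yPoint_eq_of_isReps (D : CMPointData n) (h3 : D.thm28_3) (hπ : D.piPrime * D.piPrime = 1)
    {φ φ' : Finset (ClassGroup (𝓞 (GenusField (2 * n))))} (hφ : D.IsRepsModPiPrime φ)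
    (hφ' : D.IsRepsModPiPrime φ') : (2 : ℕ) • D.yPoint φ' = (2 : ℕ) • D.yPoint φ := by
  classical
  -- the torsion shift `ε = (±1, 0)`
  set ε : EPoint D.H := if n % 8 = 7 then ptOne else ptNegOne with hε
  have hε2 : (2 : ℕ) • ε = 0 := by
    rw [hε]; split_ifs
    · exact two_nsmul_ptOne
    · exact two_nsmul_ptNegOne
  have hshift : ∀ t, D.z (D.piPrime * t) = D.z t + ε := by
    intro t
    have := h3 t
    rw [sub_eq_iff_eq_add] at this
    rw [this, hε, add_comm]
  -- split `φ′` and `φ` along `φ`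
  have hsplit' : D.yPoint φ' = (∑ t ∈ φ' with t ∈ φ, D.z t) + ∑ t ∈ φ' with t ∉ φ, D.z t := by
    rw [yPoint, ← Finset.sum_filter_add_sum_filter_not φ' (fun t => t ∈ φ)]
  have hsplit : D.yPoint φ = (∑ t ∈ φ with t ∈ φ', D.z t) + ∑ t ∈ φ with t ∉ φ', D.z t := by
    rw [yPoint, ← Finset.sum_filter_add_sum_filter_not φ (fun t => t ∈ φ')]
  -- the common part
  have hcommon : (∑ t ∈ φ' with t ∈ φ, D.z t) = ∑ t ∈ φ with t ∈ φ', D.z t := by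
    congr 1
    ext t; simp [and_comm]
  -- `φ′ ∖ φ = [ϖ′]·(φ ∖ φ′)`
  have himage : (φ'.filter fun t => t ∉ φ) = (φ.filter fun t => t ∉ φ').image (fun t => D.piPrime * t) := by
    ext t
    simp only [Finset.mem_filter, Finset.mem_image]
    constructor
    · rintro ⟨ht', ht⟩
      refine ⟨D.piPrime * t, ⟨?_, ?_⟩, ?_⟩
      · rcases hφ t with ⟨h, -⟩ | ⟨h, -⟩
        · exact absurd h ht
        · exact h
      · intro h
        rcases hφ' t with ⟨-, h'⟩ | ⟨-, h'⟩
        · exact h' h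
        · exact h' ht'
      · rw [← mul_assoc, hπ, one_mul]
    · rintro ⟨u, ⟨hu, hu'⟩, rfl⟩
      refine ⟨?_, ?_⟩
      · rcases hφ' u with ⟨h, -⟩ | ⟨h, -⟩
        · exact absurd h hu'
        · exact h
      · intro h
        rcases hφ u with ⟨-, h'⟩ | ⟨-, h'⟩
        · exact h' h
        · exact h' hu
  have hinj : Set.InjOn (fun t => D.piPrime * t) ↑(φ.filter fun t => t ∉ φ') := by
    intro a _ b _ hab
    exact mul_left_cancel hab
  have hrest : (∑ t ∈ φ' with t ∉ φ, D.z t) = (∑ t ∈ φ with t ∉ φ', D.z t) +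
      (φ.filter fun t => t ∉ φ').card • ε := by
    rw [himage, Finset.sum_image hinj, Finset.sum_congr rfl (fun t _ => hshift t), Finset.sum_add_distrib,
      Finset.sum_const]
  rw [hsplit', hsplit, hcommon, hrest, smul_add, smul_add, smul_add, smul_comm, hε2, smul_zero, add_zero]

/-- **Monsky Thm. 4.5 (first half) / Tian Prop. 4.6 (4.7)–(4.9), on the data**: for a transversal `φ`,
`2·y_{2n,φ}` is fixed by `σ_{1+ϖ}` and by every `σ_s`, hence by every automorphism fixing `√−2n`, and is negated
by every automorphism moving `√−2n`; therefore it is the transfer of a rational point of `E_{2n}`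
("`2S_N` is rational over `ℚ(i√N)`, … transformed into its negative by complex conjugation", Monsky p. 57;
"`2y_m ∈ E(ℚ(√−m))⁻`", Tian p0023 L28–L45). Uses `thm28_1`, `thm28_2`, `thm28_3`, `eq48`, `galoisFacts`.
[cite: Monsky1990MockHeegner, Thm. 4.5 (p. 57)] [cite: Tian2014, Prop. 4.6 proof (p0023 L26–L45)] -/
theorem exists_transfer_eq_two_nsmul_yPoint (D : CMPointData n) (hn : n ≠ 0) (hP : D.Printed)
    {φ : Finset (ClassGroup (𝓞 (GenusField (2 * n))))} (hφ : D.IsRepsModPiPrime φ) :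
    ∃ y' : (congruentNumberCurve (2 * n)).toAffine.Point, D.transfer hn y' = (2 : ℕ) • D.yPoint φ := by
  classical
  obtain ⟨h1, h2, h3, h48, hart, ⟨htaui, htauθ, htau2⟩, ⟨hconji, hconjθ, hconj2⟩, -, hgalK, hπ, -⟩ := hP
  set P : EPoint D.H := (2 : ℕ) • D.yPoint φ with hPdef
  -- `τ` fixes `P`
  have htau : D.act D.tau P = P := by
    rw [hPdef, map_nsmul, yPoint, map_sum, Finset.sum_congr rfl (fun t _ => h1 t), Finset.sum_add_distrib,
      Finset.sum_const, smul_add, smul_comm, two_nsmul_ptZero, smul_zero, add_zero]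
  -- every `σ_s` fixes `P`
  have hσ : ∀ s, D.act (D.art s) P = P := by
    intro s
    have : D.act (D.art s) (D.yPoint φ) = D.yPoint (φ.image (fun t => s * t)) := by
      rw [yPoint, map_sum, Finset.sum_congr rfl (fun t _ => h48 s t), yPoint,
        Finset.sum_image (fun a _ b _ hab => mul_left_cancel hab)]
    rw [hPdef, map_nsmul, this, D.two_nsmul_yPoint_eq_of_isReps h3 hπ hφ (D.isRepsModPiPrime_image_mul hφ s)]
  -- complex conjugation negates `P`
  have hconj : D.act D.conj P = -P := by
    have : D.act D.conj (D.yPoint φ) = -D.yPoint (φ.image (fun t => t⁻¹)) + φ.card • ptOne := by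
      rw [yPoint, map_sum, Finset.sum_congr rfl (fun t _ => h2 t), Finset.sum_add_distrib, Finset.sum_const,
        Finset.sum_neg_distrib, yPoint, Finset.sum_image (fun a _ b _ hab => inv_injective hab)]
    rw [hPdef, map_nsmul, this, smul_add, smul_neg, smul_comm, two_nsmul_ptOne, smul_zero, add_zero,
      D.two_nsmul_yPoint_eq_of_isReps h3 hπ hφ (D.isRepsModPiPrime_image_inv hπ hφ)]
  -- hence every automorphism fixing `√−2n` fixes `P`
  have hfix : ∀ g : D.H ≃ₐ[ℚ] D.H, g D.sqrtNegTwoN = D.sqrtNegTwoN → D.act g P = P := by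
    intro g hg
    have hle : Subgroup.closure (Set.range D.art ∪ {D.tau}) ≤ D.stabilizer P := by
      rw [Subgroup.closure_le]
      rintro σ (⟨s, rfl⟩ | hσ)
      · exact hσ s
      · rw [Set.mem_singleton_iff] at hσ
        rw [hσ]; exact htau
    exact hle (hgalK g hg)
  -- and every automorphism moving `√−2n` negates `P`
  have hneg : ∀ g : D.H ≃ₐ[ℚ] D.H, g D.sqrtNegTwoN = -D.sqrtNegTwoN → D.act g P = -P := by
    intro g hg
    have h' : (D.conj * g) D.sqrtNegTwoN = D.sqrtNegTwoN := by
      rw [AlgEquiv.mul_apply, hg, map_neg, hconjθ, neg_neg]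
    have := hfix _ h'
    rw [D.act_mul] at this
    have h'' := congrArg (D.act D.conj) this
    rw [← D.act_mul, hconj2, D.act_one] at h''
    rw [h'', hconj]
  exact exists_transferE_eq_of_forall_gal (2 * n) D.sqrtNegTwoN D.sqrtNegTwoN_sq' (D.sqrtNegTwoN_ne_zero hn) P
    hfix hneg

end CMPointData

/-! ## §K1.c Monsky Thm. 4.7 transplanted: `B`-stable transversals -/

namespace CMPointData

variable {n : ℕ}

/-- **Changing the transversal, exact form**: `y_{2n,φ′} = y_{2n,φ} + Σ_{t ∈ φ ∖ φ′} (±1, 0)` (Tian §4.2 / Monsky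
Remark p. 57). [cite: Tian2014, §4.2 (p0022 L89–L94)] [cite: Monsky1990MockHeegner, Remark (p. 57)] -/
theorem yPoint_eq_add_sum_of_isReps (D : CMPointData n) (h3 : D.thm28_3) (hπ : D.piPrime * D.piPrime = 1)
    {φ φ' : Finset (ClassGroup (𝓞 (GenusField (2 * n))))} (hφ : D.IsRepsModPiPrime φ)
    (hφ' : D.IsRepsModPiPrime φ') :
    D.yPoint φ' = D.yPoint φ +
      ∑ _t ∈ φ.filter (fun t => t ∉ φ'), (if n % 8 = 7 then ptOne else ptNegOne : EPoint D.H) := by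
  classical
  set ε : EPoint D.H := if n % 8 = 7 then ptOne else ptNegOne with hε
  have hshift : ∀ t, D.z (D.piPrime * t) = D.z t + ε := by
    intro t
    have := h3 t
    rw [sub_eq_iff_eq_add] at this
    rw [this, hε, add_comm]
  have hsplit' : D.yPoint φ' = (∑ t ∈ φ' with t ∈ φ, D.z t) + ∑ t ∈ φ' with t ∉ φ, D.z t := by
    rw [yPoint, ← Finset.sum_filter_add_sum_filter_not φ' (fun t => t ∈ φ)]
  have hsplit : D.yPoint φ = (∑ t ∈ φ with t ∈ φ', D.z t) + ∑ t ∈ φ with t ∉ φ', D.z t := by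
    rw [yPoint, ← Finset.sum_filter_add_sum_filter_not φ (fun t => t ∈ φ')]
  have hcommon : (∑ t ∈ φ' with t ∈ φ, D.z t) = ∑ t ∈ φ with t ∈ φ', D.z t := by
    congr 1
    ext t; simp [and_comm]
  have himage : (φ'.filter fun t => t ∉ φ) = (φ.filter fun t => t ∉ φ').image (fun t => D.piPrime * t) := by
    ext t
    simp only [Finset.mem_filter, Finset.mem_image]
    constructor
    · rintro ⟨ht', ht⟩
      refine ⟨D.piPrime * t, ⟨?_, ?_⟩, ?_⟩
      · rcases hφ t with ⟨h, -⟩ | ⟨h, -⟩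
        · exact absurd h ht
        · exact h
      · intro h
        rcases hφ' t with ⟨-, h'⟩ | ⟨-, h'⟩
        · exact h' h
        · exact h' ht'
      · rw [← mul_assoc, hπ, one_mul]
    · rintro ⟨u, ⟨hu, hu'⟩, rfl⟩
      refine ⟨?_, ?_⟩
      · rcases hφ' u with ⟨h, -⟩ | ⟨h, -⟩
        · exact absurd h hu'
        · exact h
      · intro h
        rcases hφ u with ⟨-, h'⟩ | ⟨-, h'⟩
        · exact h' h
        · exact h' hu
  have hinj : Set.InjOn (fun t => D.piPrime * t) ↑(φ.filter fun t => t ∉ φ') := by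
    intro a _ b _ hab
    exact mul_left_cancel hab
  have hrest : (∑ t ∈ φ' with t ∉ φ, D.z t) = (∑ t ∈ φ with t ∉ φ', D.z t) +
      ∑ _t ∈ φ.filter (fun t => t ∉ φ'), ε := by
    rw [himage, Finset.sum_image hinj, Finset.sum_congr rfl (fun t _ => hshift t), Finset.sum_add_distrib]
  rw [hsplit', hsplit, hcommon, hrest, add_assoc]

/-- **`y_{2n,φ}` does not depend on the `B`-stable transversal `φ`** (`B` ambiguous of order `2`, `B ≠ 1`):
the correction set `φ ∖ φ′` is `B`-stable, so the `2`-torsion sum vanishes (Monsky Thm. 4.7: "`φ′ ∩ φ*` is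
`B`-stable … even"). [cite: Monsky1990MockHeegner, Thm. 4.7 proof (pp. 57–58)] -/
theorem yPoint_eq_of_isReps_of_isStableUnder (D : CMPointData n) (h3 : D.thm28_3)
    (hπ : D.piPrime * D.piPrime = 1) {B : ClassGroup (𝓞 (GenusField (2 * n)))} (hB2 : B * B = 1)
    (hB1 : B ≠ 1) {φ φ' : Finset (ClassGroup (𝓞 (GenusField (2 * n))))} (hφ : D.IsRepsModPiPrime φ)
    (hφ' : D.IsRepsModPiPrime φ') (hs : IsStableUnder B φ) (hs' : IsStableUnder B φ') :
    D.yPoint φ' = D.yPoint φ := by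
  classical
  rw [D.yPoint_eq_add_sum_of_isReps h3 hπ hφ hφ',
    sum_const_eq_zero_of_stable hB2 hB1 (isStableUnder_filter_not_mem hB2 hs hs'), add_zero]
  split_ifs
  · rw [← two_nsmul]; exact two_nsmul_ptOne
  · rw [← two_nsmul]; exact two_nsmul_ptNegOne

/-- **Monsky Thm. 4.7 transplanted (CLAIM (4.7-T) of the second read L2-38 §6)**: for an ambiguous class `B`
of order `2`, `B ≠ 1`, and a `B`-stable transversal `φ` of `𝒜/[ϖ′]`, the point `y_{2n,φ}` is fixed by `σ_{1+ϖ}`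
and by every `σ_s`, and negated by complex conjugation; hence it is the transfer of a rational point of `E_{2n}`
("`S_N ∈ Λ_N`"). Inputs: `thm28_1`, `thm28_2`, `thm28_3`, `eq48`, `galoisFacts` and the parity argument.
[cite: Monsky1990MockHeegner, Thm. 4.7 (pp. 57–58)] [cite: Tian2014, Thm. 2.8 (p0011 L37–L44), (4.8) (p0023 L46–L50)] -/
theorem exists_transfer_eq_yPoint_of_isStableUnder (D : CMPointData n) (hn : n ≠ 0) (hP : D.Printed)
    {B : ClassGroup (𝓞 (GenusField (2 * n)))} (hB2 : B * B = 1) (hB1 : B ≠ 1)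
    {φ : Finset (ClassGroup (𝓞 (GenusField (2 * n))))} (hφ : D.IsRepsModPiPrime φ)
    (hs : IsStableUnder B φ) :
    ∃ y' : (congruentNumberCurve (2 * n)).toAffine.Point, D.transfer hn y' = D.yPoint φ := by
  classical
  obtain ⟨h1, h2, h3, h48, hart, ⟨htaui, htauθ, htau2⟩, ⟨hconji, hconjθ, hconj2⟩, -, hgalK, hπ, -⟩ := hP
  set P : EPoint D.H := D.yPoint φ with hPdef
  -- `τ` fixes `P`: the correction `Σ_φ (0,0)` vanishes by `B`-stability
  have htau : D.act D.tau P = P := by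
    rw [hPdef, yPoint, map_sum, Finset.sum_congr rfl (fun t _ => h1 t), Finset.sum_add_distrib,
      sum_const_eq_zero_of_stable hB2 hB1 hs (by rw [← two_nsmul]; exact two_nsmul_ptZero), add_zero]
  -- every `σ_s` fixes `P`
  have hσ : ∀ s, D.act (D.art s) P = P := by
    intro s
    have : D.act (D.art s) (D.yPoint φ) = D.yPoint (φ.image (fun t => s * t)) := by
      rw [yPoint, map_sum, Finset.sum_congr rfl (fun t _ => h48 s t), yPoint,
        Finset.sum_image (fun a _ b _ hab => mul_left_cancel hab)]
    rw [hPdef, this]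
    exact D.yPoint_eq_of_isReps_of_isStableUnder h3 hπ hB2 hB1 hφ (D.isRepsModPiPrime_image_mul hφ s) hs
      (isStableUnder_image_mul hs s)
  -- complex conjugation negates `P`
  have hconj : D.act D.conj P = -P := by
    have : D.act D.conj (D.yPoint φ) = -D.yPoint (φ.image (fun t => t⁻¹)) + ∑ _t ∈ φ, (ptOne : EPoint D.H) := by
      rw [yPoint, map_sum, Finset.sum_congr rfl (fun t _ => h2 t), Finset.sum_add_distrib,
        Finset.sum_neg_distrib, yPoint, Finset.sum_image (fun a _ b _ hab => inv_injective hab)]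
    rw [hPdef, this, sum_const_eq_zero_of_stable hB2 hB1 hs (by rw [← two_nsmul]; exact two_nsmul_ptOne),
      add_zero, D.yPoint_eq_of_isReps_of_isStableUnder h3 hπ hB2 hB1 hφ (D.isRepsModPiPrime_image_inv hπ hφ)
      hs (isStableUnder_image_inv hB2 hs)]
  -- hence every automorphism fixing `√−2n` fixes `P`, every automorphism moving it negates `P`
  have hfix : ∀ g : D.H ≃ₐ[ℚ] D.H, g D.sqrtNegTwoN = D.sqrtNegTwoN → D.act g P = P := by
    intro g hg
    have hle : Subgroup.closure (Set.range D.art ∪ {D.tau}) ≤ D.stabilizer P := by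
      rw [Subgroup.closure_le]
      rintro σ (⟨s, rfl⟩ | hσ)
      · exact hσ s
      · rw [Set.mem_singleton_iff] at hσ
        rw [hσ]; exact htau
    exact hle (hgalK g hg)
  have hneg : ∀ g : D.H ≃ₐ[ℚ] D.H, g D.sqrtNegTwoN = -D.sqrtNegTwoN → D.act g P = -P := by
    intro g hg
    have h' : (D.conj * g) D.sqrtNegTwoN = D.sqrtNegTwoN := by
      rw [AlgEquiv.mul_apply, hg, map_neg, hconjθ, neg_neg]
    have := hfix _ h'
    rw [D.act_mul] at this
    have h'' := congrArg (D.act D.conj) this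
    rw [← D.act_mul, hconj2, D.act_one] at h''
    rw [h'', hconj]
  exact exists_transferE_eq_of_forall_gal (2 * n) D.sqrtNegTwoN D.sqrtNegTwoN_sq' (D.sqrtNegTwoN_ne_zero hn) P
    hfix hneg

end CMPointData

/-! ## §K1.d `(0,0)` under the transfer; Thm. 4.7 for EVERY transversal -/

section TwoTorsionTransfer

variable (N : ℕ) {H : Type} [Field H] [CharZero H]

/-- `(0, 0)` is a point of `E_N`. [cite: Monsky1990MockHeegner, p. 45 ("E^{(N)}_ℚ has torsion ℤ/2 × ℤ/2")] [folklore] -/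
theorem nonsingular_zero_zero (N : ℕ) (hN : N ≠ 0) :
    (congruentNumberCurve N).toAffine.Nonsingular 0 0 := by
  have hΔ : (congruentNumberCurve N).Δ ≠ 0 := by
    rw [congruentNumberCurve_Δ]; exact mul_ne_zero (by norm_num) (pow_ne_zero _ (by exact_mod_cast hN))
  rw [← WeierstrassCurve.Affine.equation_iff_nonsingular_of_Δ_ne_zero hΔ,
    WeierstrassCurve.Affine.equation_iff]
  simp [congruentNumberCurve]

/-- `(0, 0) ↦ (0, 0)` under the transfer. [cite: Monsky1990MockHeegner, Lemma 4.3 (p. 56)] -/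
theorem transferE_some_zero_zero (hN : N ≠ 0) (θ : H) (hθ2 : θ ^ 2 = algebraMap ℚ H (-(N : ℚ)))
    (hθ : θ ≠ 0) : transferE N θ hθ2 hθ (.some _ _ (nonsingular_zero_zero N hN)) = ptZero := by
  simp only [transferE, AddMonoidHom.comp_apply, AddEquiv.coe_toAddMonoidHom]
  rw [WeierstrassCurve.Affine.Point.congrEquiv_some]
  obtain ⟨h'', hι⟩ := ιK_some (H := H) _ (congruentNumberCurve_eq_quadraticTwist N ▸ nonsingular_zero_zero N hN)
  rw [hι]
  obtain ⟨h3, he⟩ := untwistEquivAt_some (congruentNumberCurve 1) hθ2 hθ h''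
  rw [he, ptZero]
  simp

end TwoTorsionTransfer

namespace CMPointData

variable {n : ℕ}

/-- **Monsky Thm. 4.7 transplanted, for EVERY transversal** ("changing `φ` translates `S_{N,φ}` by an element
of `T ⊂ Λ_N`", Remark p. 57): given an ambiguous class `B` of order `2` with `B ∉ {1, [ϖ′]}` (printed for
composite `n`: "`B` is ambiguous, but is neither principal nor `m`", p. 57), `y_{2n,φ}` is the transfer of a
rational point of `E_{2n}` for every transversal `φ` of `𝒜/[ϖ′]`.
[cite: Monsky1990MockHeegner, Thm. 4.7 and the Remark (p. 57)] -/
theorem exists_transfer_eq_yPoint (D : CMPointData n) (hn : n ≠ 0) (hP : D.Printed)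
    {B : ClassGroup (𝓞 (GenusField (2 * n)))} (hB2 : B * B = 1) (hB1 : B ≠ 1) (hBπ : B ≠ D.piPrime)
    {φ : Finset (ClassGroup (𝓞 (GenusField (2 * n))))} (hφ : D.IsRepsModPiPrime φ) :
    ∃ y' : (congruentNumberCurve (2 * n)).toAffine.Point, D.transfer hn y' = D.yPoint φ := by
  classical
  have hP' := hP
  obtain ⟨-, -, h3, -, -, -, -, -, -, hπ, hπ1⟩ := hP'
  obtain ⟨φ₀, hφ₀, hs₀⟩ := exists_isReps_isStableUnder D.piPrime B hπ hπ1 hB2 hB1 hBπ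
  obtain ⟨y₀, hy₀⟩ := D.exists_transfer_eq_yPoint_of_isStableUnder hn hP hB2 hB1 hφ₀ hs₀
  have hN0 : 2 * n ≠ 0 := by omega
  -- the correction is a multiple of a rational `2`-torsion point
  set ε₀ : (congruentNumberCurve (2 * n)).toAffine.Point :=
    if n % 8 = 7 then twoTorsionNegN (2 * n) hN0 else twoTorsionPosN (2 * n) hN0 with hε₀
  have hε : D.transfer hn ε₀ = (if n % 8 = 7 then ptOne else ptNegOne : EPoint D.H) := by
    rw [hε₀]; split_ifs
    · exact transferE_twoTorsionNegN (2 * n) hN0 _ _ _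
    · exact transferE_twoTorsionPosN (2 * n) hN0 _ _ _
  refine ⟨y₀ + (φ₀.filter fun t => t ∉ φ).card • ε₀, ?_⟩
  rw [map_add, map_nsmul, hy₀, hε, D.yPoint_eq_add_sum_of_isReps h3 hπ hφ₀ hφ, Finset.sum_const]

end CMPointData


end Literature.NumberTheory.EllipticCurves.Tian2014

end
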